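import Summits.Ventures.HodgeRepro.Groups
import Summits.Ventures.HodgeRepro.Night1ProductDischarge

/-!
# The degree-8 level-3 class `B₃` on the five Galois groups of order 8: the reduction-free C5′ discharge at
`p = 24`, group by group

Blind re-derivation cell `pub-hodge-repro`, seat `night-1` (gen 2).  `Night1ProductDischarge.lean` proves
`level3Family_weilAlgebraic` for every `(G, c)` of order 8 with an enumeration `π` of its four places.  This
file instantiates it on the five groups of the sealed degree-8 rows (typer's `Groups.lean`: `C8`, `C4xC2` with its
three complex conjugations, `C2xC2xC2`, `D4`, `Q8` — the sealed namespaces `Octic.Cyclic`, `Octic.C4C2Square` /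
`Octic.C4C2Nonsquare`, `Octic.Triquadratic`, `Octic.Dihedral`, `Octic.Quaternion`), with an explicit place
enumeration certified by `decide`, for EVERY CM type `Φ` of the group: ROUTE.md §3.6 (ii)'s 24-fold
`B₃ = A_{Φ̄}² × ∏_j A_{Φ^{(π_j)}}` — the one degree-8 `(eq2)`-class the rank-four faces do not reach directly
(Lemma R fails on the repeated corner) — is discharged from `ProdClauses 24 3` (BMM Cor 2 at `(24, 3)`, Liu Cor
4.20 at rank `25`, R7, DR, Liu–Shimura, R5, the Weil-line clause) on every Galois CM field of degree 8.  The
route's closer table row «the degree-8 level-3 class §3.6 (ii): C5′ with k = 3, g = 24, p = 24 (Liu at n = 25,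
conditional through R2.3)» is thereby a kernel theorem on each sealed group.

Every theorem is the implication «printed clauses ⟹ the Weil line is algebraic»; BMM Cor 2 is printed-conditional
(O-R2.3).  Nothing here says anything about the status of the Hodge conjecture for CM abelian varieties, which is
NOT proved.
-/

set_option autoImplicit false

open Finset
open scoped Pointwise

namespace HodgeRepro

namespace Level3Degree8

/-! ### `C8`, `c = 4` (sealed `Octic.Cyclic`) -/

/-- Place representatives of `(C8, 4)`: `0, 1, 2, 3` (the places `{k, k + 4}`). -/
def places_C8 : Fin 4 → C8 :=
  ![Multiplicative.ofAdd 0, Multiplicative.ofAdd 1, Multiplicative.ofAdd 2, Multiplicative.ofAdd 3]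

/-- They enumerate the four places. -/
theorem places_C8_isPlaceEnum : IsPlaceEnum cc_C8 places_C8 := by decide

/-- **`B₃` on `C8` discharged at `p = 24`** for every CM type `Φ` of `(C8, 4)`. -/
theorem level3_C8 (V : RouteC.Vocab C8 cc_C8) {Φ : Finset C8} (hΦ : IsCMType cc_C8 Φ)
    (H : V.ProdClauses 24 3) : V.WeilAlgebraic (level3Family cc_C8 Φ places_C8) :=
  level3Family_weilAlgebraic cc_C8_isComplexConj card_C8 hΦ places_C8_isPlaceEnum V H

/-! ### `C4 × C2`, the three complex conjugations (sealed `Octic.C4C2Square` (conj `(2,0)`) and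
`Octic.C4C2Nonsquare` (conj `(0,1)`); `(2,1)` is the third central involution) -/

/-- Place representatives of `(C4 × C2, (2,0))`: `(0,0), (1,0), (0,1), (1,1)`. -/
def places_C4xC2_sq : Fin 4 → C4xC2 :=
  ![Multiplicative.ofAdd (0, 0), Multiplicative.ofAdd (1, 0), Multiplicative.ofAdd (0, 1),
    Multiplicative.ofAdd (1, 1)]

/-- They enumerate the four places. -/
theorem places_C4xC2_sq_isPlaceEnum : IsPlaceEnum cc_C4xC2_sq places_C4xC2_sq := by decide

/-- **`B₃` on `(C4 × C2, (2,0))` discharged at `p = 24`** for every CM type `Φ`. -/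
theorem level3_C4xC2_sq (V : RouteC.Vocab C4xC2 cc_C4xC2_sq) {Φ : Finset C4xC2}
    (hΦ : IsCMType cc_C4xC2_sq Φ) (H : V.ProdClauses 24 3) :
    V.WeilAlgebraic (level3Family cc_C4xC2_sq Φ places_C4xC2_sq) :=
  level3Family_weilAlgebraic cc_C4xC2_sq_isComplexConj card_C4xC2 hΦ places_C4xC2_sq_isPlaceEnum V H

/-- Place representatives of `(C4 × C2, (0,1))`: `(0,0), (1,0), (2,0), (3,0)`. -/
def places_C4xC2_ns : Fin 4 → C4xC2 :=
  ![Multiplicative.ofAdd (0, 0), Multiplicative.ofAdd (1, 0), Multiplicative.ofAdd (2, 0),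
    Multiplicative.ofAdd (3, 0)]

/-- They enumerate the four places. -/
theorem places_C4xC2_ns_isPlaceEnum : IsPlaceEnum cc_C4xC2_ns places_C4xC2_ns := by decide

/-- **`B₃` on `(C4 × C2, (0,1))` discharged at `p = 24`** for every CM type `Φ`. -/
theorem level3_C4xC2_ns (V : RouteC.Vocab C4xC2 cc_C4xC2_ns) {Φ : Finset C4xC2}
    (hΦ : IsCMType cc_C4xC2_ns Φ) (H : V.ProdClauses 24 3) :
    V.WeilAlgebraic (level3Family cc_C4xC2_ns Φ places_C4xC2_ns) :=
  level3Family_weilAlgebraic cc_C4xC2_ns_isComplexConj card_C4xC2 hΦ places_C4xC2_ns_isPlaceEnum V H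

/-- Place representatives of `(C4 × C2, (2,1))`: `(0,0), (1,0), (0,1), (1,1)`. -/
def places_C4xC2_ns' : Fin 4 → C4xC2 :=
  ![Multiplicative.ofAdd (0, 0), Multiplicative.ofAdd (1, 0), Multiplicative.ofAdd (0, 1),
    Multiplicative.ofAdd (1, 1)]

/-- They enumerate the four places. -/
theorem places_C4xC2_ns'_isPlaceEnum : IsPlaceEnum cc_C4xC2_ns' places_C4xC2_ns' := by decide

/-- **`B₃` on `(C4 × C2, (2,1))` discharged at `p = 24`** for every CM type `Φ`. -/
theorem level3_C4xC2_ns' (V : RouteC.Vocab C4xC2 cc_C4xC2_ns') {Φ : Finset C4xC2}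
    (hΦ : IsCMType cc_C4xC2_ns' Φ) (H : V.ProdClauses 24 3) :
    V.WeilAlgebraic (level3Family cc_C4xC2_ns' Φ places_C4xC2_ns') :=
  level3Family_weilAlgebraic cc_C4xC2_ns'_isComplexConj card_C4xC2 hΦ places_C4xC2_ns'_isPlaceEnum V H

/-! ### `C2 × C2 × C2`, `c = (1,0,0)` (sealed `Octic.Triquadratic`; the sixfold `A × E × E′` row) -/

/-- Place representatives of `(C2³, (1,0,0))`: `(0,b,c)`. -/
def places_C2xC2xC2 : Fin 4 → C2xC2xC2 :=
  ![Multiplicative.ofAdd (0, 0, 0), Multiplicative.ofAdd (0, 1, 0), Multiplicative.ofAdd (0, 0, 1),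
    Multiplicative.ofAdd (0, 1, 1)]

/-- They enumerate the four places. -/
theorem places_C2xC2xC2_isPlaceEnum : IsPlaceEnum cc_C2xC2xC2 places_C2xC2xC2 := by decide

/-- **`B₃` on `C2³` discharged at `p = 24`** for every CM type `Φ` of `(C2³, (1,0,0))` — in particular for the
type `Φ = {(0,b,c)}` (mask `85`) of the sealed sixfold `A × E × E′` (rep `(85, 3, 12)`), where `B₃ = E^8 × (the
four single flips)`, ROUTE.md §3.6 (ii)'s «`A_{Φ̄}² × ∏ A_{Φ^{(i)}}`». -/
theorem level3_C2xC2xC2 (V : RouteC.Vocab C2xC2xC2 cc_C2xC2xC2) {Φ : Finset C2xC2xC2}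
    (hΦ : IsCMType cc_C2xC2xC2 Φ) (H : V.ProdClauses 24 3) :
    V.WeilAlgebraic (level3Family cc_C2xC2xC2 Φ places_C2xC2xC2) :=
  level3Family_weilAlgebraic cc_C2xC2xC2_isComplexConj card_C2xC2xC2 hΦ places_C2xC2xC2_isPlaceEnum V H

/-- The sealed sixfold's type `Φ = {(0,b,c)}` (mask `85`) is a CM type of `(C2³, (1,0,0))`. -/
theorem mask85_isCMType :
    IsCMType cc_C2xC2xC2 {Multiplicative.ofAdd (0, 0, 0), Multiplicative.ofAdd (0, 1, 0),
      Multiplicative.ofAdd (0, 0, 1), Multiplicative.ofAdd (0, 1, 1)} := by decide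

/-- `B₃` for the sealed sixfold's type, explicitly. -/
theorem level3_C2xC2xC2_mask85 (V : RouteC.Vocab C2xC2xC2 cc_C2xC2xC2) (H : V.ProdClauses 24 3) :
    V.WeilAlgebraic (level3Family cc_C2xC2xC2 {Multiplicative.ofAdd (0, 0, 0), Multiplicative.ofAdd (0, 1, 0),
      Multiplicative.ofAdd (0, 0, 1), Multiplicative.ofAdd (0, 1, 1)} places_C2xC2xC2) :=
  level3_C2xC2xC2 V mask85_isCMType H

/-! ### `D4`, `c = r²` (sealed `Octic.Dihedral`) -/

/-- Place representatives of `(D4, r²)`: `1, r, s, sr` (the places `{r^i, r^{i+2}}`, `{s r^i, s r^{i+2}}`). -/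
def places_D4 : Fin 4 → D4 := ![DihedralGroup.r 0, DihedralGroup.r 1, DihedralGroup.sr 0, DihedralGroup.sr 1]

/-- They enumerate the four places. -/
theorem places_D4_isPlaceEnum : IsPlaceEnum cc_D4 places_D4 := by decide

/-- **`B₃` on `D4` discharged at `p = 24`** for every CM type `Φ` of `(D4, r²)`. -/
theorem level3_D4 (V : RouteC.Vocab D4 cc_D4) {Φ : Finset D4} (hΦ : IsCMType cc_D4 Φ)
    (H : V.ProdClauses 24 3) : V.WeilAlgebraic (level3Family cc_D4 Φ places_D4) :=
  level3Family_weilAlgebraic cc_D4_isComplexConj card_D4 hΦ places_D4_isPlaceEnum V H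

/-! ### `Q8`, `c = a²` (sealed `Octic.Quaternion`) -/

/-- Place representatives of `(Q8, a²)`: `1, a, x, xa`. -/
def places_Q8 : Fin 4 → Q8 :=
  ![QuaternionGroup.a 0, QuaternionGroup.a 1, QuaternionGroup.xa 0, QuaternionGroup.xa 1]

/-- They enumerate the four places. -/
theorem places_Q8_isPlaceEnum : IsPlaceEnum cc_Q8 places_Q8 := by decide

/-- **`B₃` on `Q8` discharged at `p = 24`** for every CM type `Φ` of `(Q8, a²)`. -/
theorem level3_Q8 (V : RouteC.Vocab Q8 cc_Q8) {Φ : Finset Q8} (hΦ : IsCMType cc_Q8 Φ)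
    (H : V.ProdClauses 24 3) : V.WeilAlgebraic (level3Family cc_Q8 Φ places_Q8) :=
  level3Family_weilAlgebraic cc_Q8_isComplexConj card_Q8 hΦ places_Q8_isPlaceEnum V H

/-! ### Count: the `B₃` classes per group -/

/-- `16` CM types of `(C8, 4)`, hence `16` families `B₃(Φ)` (the `B₄`-orbit of ROUTE.md §3.6: 16 multisets). -/
theorem card_level3_C8 : (cmTypes cc_C8).card = 16 := card_cmTypes_C8

/-- `16` CM types of `(C2³, (1,0,0))`. -/
theorem card_cmTypes_C2xC2xC2 : (cmTypes cc_C2xC2xC2).card = 16 := by decide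

end Level3Degree8

end HodgeRepro
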